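import Literature.MathematicalPhysics.QuantumFieldTheory.Balaban1983to89.B8Eq142KLevelLocalGamma

/-!
# `Balaban1983to89.B8Eq142KLevelLocalGammaPrime` — [Balaban1985RegularSpaces] (1.42) p. 83 at `k` levels for the gauge-fixed fields of Theorem 4's induction,
# EDITION γ′: `pub-ymgap-dag-n05-e`'s `B8Eq142KLevelLocalGamma.H42_of_inAx_γ` (print's box law «box ⊂ Ω_{j−1}» for the datum class) with the (1.35) hypothesis
# NARROWED TO PRINT'S EXACT CLASS — «a bond of Ω_j^{(j)}: at least one end-point in Ω_j^{(j)}» (p. 77), i.e. at least one end-BLOCK inside `Ω_j` — under the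
# all-truncation tower law «`Bʲ(y) ⊂ Ω_j` for `y ∈ Λs m j`» (referee `pub-ymgap-dag-ref-E` g13 NOTE-2 on p580875: «every use of `h135` is at a bond with an end-point in
# `Λs m j` … a print-faithful guard would carry the same proof»)

statement-level skeleton of published theorems with citation tags; proofs where landed; nothing here is a claim about the
Yang–Mills mass gap

PDF held: `paper:balaban1985-cmp99-regular-spaces-gauge-fixing` (journal page = PDF page + 74); p. 77 *«If Ω ⊂ T_η then we denote by Ω also the set of bonds st(Ω) =
{bonds b ⊂ T: at least one end-point of b belongs to Ω} … This convention applies to an arbitrary lattice»*, (1.4) p. 77 `Ω_j = Bʲ(Ω_j^{(j)})`, (1.31) p. 82, (1.35) p. 82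
*«on Λ_j»*, (1.37) p. 82, (1.42) p. 83 *«|B| < 2dLα₁»*, (1.66) p. 87 *«on Ω_j^{(j)}»* — read first-hand this session.

CITATION HEADER (lean-in-tree rule).  Cell `pub-ymgap` (HUMAN RULING D-0062 ∕ D-0149, Track A), DAG node N05 = [B8], width seat `pub-ymgap-dag-n05-w2` (g0), key K1⁷
`stmt-QuantumFields-20542` (helper, count-neutral).  WHY THIS FILE.  The N05 carrier is being re-typed (`pub-ymgap-dag-n05-d` g10 `B8Prop3ShellModeVacuity` p585094 ⇒
`zdGF3P`: (1.37)∕(1.42) `C137` over print's class `towerBondsP` WITH the crossing bonds).  Theorem 2∕4's CONCLUSION `C137 α₁` then asks «‖Q_j‖ < 2dLα₁» AT the crossing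
bonds, which needs (1.35) ≤ α₁ AT those bonds (r05's `norm_Qj_lt_crossing_loc`, input `h135b`) — print's (1.35)∕(1.66) give exactly that (one-end-point class), the
tree's box-form letter does not (only `26384(d+1)L·α₁` there, this seat's `B8Ineq166OneLevelUp`), and dag-n05-e's `H42_of_inAx_γ` asks (1.35) on the LARGER class «box ⊂
Ω_{j−1}» (collar bonds included), which print's letter does not supply and which, put on the carrier, would make Proposition 7's CONCLUSION (1.145) stronger than print
(`pub-ymgap-dag-n05-w1` g0, bus).  THIS FILE states (1.42) with the (1.35) input in PRINT'S EXACT CLASS, so that a carrier whose `avgClose`∕`avgClose166` read the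
one-end-point class (verbatim print, both as Theorem 2∕4's hypothesis and as Proposition 7's conclusion) feeds it with NO constant change: ★ `H42_of_inAx_γ'` = n05-e's
`H42_of_inAx_γ` with `h135` guarded by «`Bʲ(z) ⊂ Ω_j ∨ Bʲ(z + e_μ) ⊂ Ω_j`» and the extra law («`Bʲ(y) ⊂ Ω_j` for every `y ∈ Λs m j`» at the truncation `m` in play, displayed right after `m ≤ k` —
`ZdIdx.htower` at `m = k`, the tower law (L1) of the N05 index laws `B8IdxB8Laws.tower_all` below `k`); proof = hers verbatim (cited decl by decl: the engines `norm_Qj_lt_interior_zero∕_loc`,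
`norm_Qj_lt_crossing_loc`, `…_mirrored_loc`, `eq87_of_inAx_restr129`, `inBox_box_of_blockBond(_snd)` by name), the three (1.35) reads discharged by `htw` at the datum bond's
end-point in `Λs m j` (interior ∕ crossing `c₊` ∕ mirrored `c₋`) and at the level-`j′` sub-bonds of the crossing block (both ends in `Λs m j′`).  Kind «kernel-checked proof»,
one theorem, no `def`.

HONEST SCOPE ∕ A6.  A re-guarding of a landed lemma; nothing of [4] or of Propositions 3∕5 proved; hypotheses = Theorem 4's frame at truncation `m` (inhabited, e.g. `U′ = 1`,
`Λb = ∅`), the class laws (`hbox` at `Ω_{j−1}`, `hclass`, `htw`) and the windows at `(L²α₀, Lα₂)`; conclusion unchanged `‖Q_j(U₀, iηA′)(c)‖ < 2dLα₁` on every datum bond.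
Neither γ nor γ′ implies the other (γ′: narrower (1.35) demand, one more law).  Count-neutral; N05 NOT discharged; one finite `𝕋⁴` programme at fixed `ε`, Bałaban AS PRINTED;
the Yang–Mills mass gap (Clay) is NOT proved by any of this — R4 closes the conditional finite-`𝕋⁴` rung `BalabanLadder.UV` only; nothing continuum ∕ ℝ⁴ ∕ OS ∕ mass-gap.
No `sorry`, no `def`, no `instance`, no `notation`.  Unit `pub-ymgap-dag-n05-w2` (g0), 2026-08-27.  Tree API by name only, nothing restated.

RELATED IN THE TREE, NOT DUPLICATED: `B8Eq142KLevelLocalGamma.H42_of_inAx_γ` (dag-n05-e p580875 — the «box ⊂ Ω_{j−1}»-guarded edition; USED: imports, proof pattern),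
`B8Eq142KLevelLocal.H42_of_inAx` (dag-n05-a — the «box ⊂ Ω_j» edition) and its engines (USED by name), `B8Ineq166OneLevelUp` (this seat — the box-form ⇒ «box ⊂ Ω_{j−1}»
bridge at `26384(d+1)L·α₁`, the comparison lemma between the editions), `B8TowerBondsPrinted` (dag-n05-d — print's class `towerBondsP`, a typical `Λb` here).
-/

noncomputable section

open NormedSpace

namespace Literature.MathematicalPhysics.QuantumFieldTheory.Balaban1983to89.B8Eq142KLevelLocalGammaPrime

open Complex (I)
open MatrixLog B7Prop1Explicit B7Prop2Explicit B7Prop1Local B7Eq92Concrete B7Eq99Concrete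
open B7Prop3Flat (expCfg c3 insCfg)
open B7Prop4GeneralLevels (logCovIter)
open B7Prop5Flat (bondsIn restr mem_bondsIn insCfg_restr_of_mem agreeOn_insCfg_restr BondIn)
open B7LocalityGeneral (logCovIter_congr)
open B7AvgGaugeCovariance (uLev)
open B8Ineq130 (tlo thi tlo_apply thi_apply)
open B8Ineq132 (InAk BondTouches pdevOn_lt_of_forall)
open B8Lemma1NonAbelian (mulCfg)
open B8Eq146AExpansion (iEta)
open B8Eq184Proof (cfgExp)
open B8Eq140Level (SideTouches sideTouches_of_bondTouches)
open B8Eq119TwistedAxial (InAx Restr129)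
open B8Eq131Derivation (eq87_of_inAx_restr129)
open B8Eq137QjEqB (norm_Qj_lt_interior_regular norm_Qj_lt_interior_zero)
open B8Ineq172Concrete (wrec_congr_tower)
open B8Eq184Proof (gaugeExp)
open B8Ineq132 (covDerivFwd)
open B7Prop4GeneralLevels (linCovIter)
open B8Eq155JBound (Jcur wsup)
open B8ScaledSupNorm (bondNorm msup)
open B8Thm2LogB (blockTop)
open B8Eq142KLevelLocal
open B8Ineq130 (tlo thi)

-- `Site` alone could resolve to the torus sites of `Setup.lean`; re-export the `ℤ^d` sites of `B7Prop1Explicit`.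
export B7Prop1Explicit (Site)

variable {d : ℕ}

variable {𝔸 : Type*} [CStarAlgebra 𝔸] [Nontrivial 𝔸]

/-- Two distinct lattice directions exist when `d ≥ 2` (private plumbing, as in `B8Eq142KLevelLocal`). [folklore] -/
private theorem exists_ne_dir' (hd2 : 2 ≤ d) (μ : Fin d) : ∃ κ : Fin d, κ ≠ μ := by
  by_cases h : (μ : ℕ) = 0
  · exact ⟨⟨1, by omega⟩, fun e => by have := congrArg Fin.val e; simp [h] at this⟩
  · exact ⟨⟨0, by omega⟩, fun e => by have := congrArg Fin.val e; simp at this; omega⟩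

omit [Nontrivial 𝔸] in
/-- The two exponent-field spellings agree bondwise (`B8Prop3GaugeFixedKLevel.expCfg_iEta_eq_cfgExp`; private plumbing). [folklore] -/
private theorem expCfg_iEta_apply (η : ℝ) (A : Site d → Fin d → 𝔸) (x : Site d) (κ : Fin d) :
    expCfg (iEta η A) x κ = cfgExp η A x κ :=
  congrFun (congrFun (B8Prop3GaugeFixedKLevel.expCfg_iEta_eq_cfgExp η A) x) κ

/-- ★ **THE (1.42) CLAUSE AT `k` LEVELS FOR GAUGE-FIXED FIELDS ON A GENERAL CONSTRAINT-BOND FAMILY, EDITION γ′ — PRINT's BOX LAW «box ⊂ Ω_{j−1}» FOR THE CLASS,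
PRINT's ONE-END-POINT CLASS FOR (1.35).**  dag-n05-e's `H42_of_inAx_γ` with the (1.35) hypothesis `h135` required only at level-`j` bonds ONE OF WHOSE END-BLOCKS lies in `Ω_j`
(«at least one end-point in Ω_j^{(j)}», p. 77; (1.35) «on Λ_j», (1.66) «on Ω_j^{(j)}») and, at the truncation `m` in play, the tower law («`Bʲ(y) ⊂ Ω_j` for `y ∈ Λs m j`», displayed after `m ≤ k`; `ZdIdx.htower` serves at `m = k`): for every
gauge-fixed `W = U′^{u⁻¹} = e^{iηA′}` of Theorem 4's induction (truncation `m`, (1.29) `Restr129`, the gauge condition `Lan m W`, `A′` the masked self-adjoint exponent with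
`‖A′‖ ≤ α₂(Lʲη)⁻¹` on the sides touching `Ω_j`) and every datum bond `c ∈ Λb m j`: `‖Q_j(U₀, iηA′)(c)‖ < 2dLα₁`.  Proof = n05-e's; the three (1.35) reads are at the datum bond
(an end-point in `Λs m j` by `hclass`) and at the level-`j′` sub-bonds of a crossing block (both end-points in `Λs m j′`), each inside `Ω` by `htw`.
[cite: Balaban1985RegularSpaces, (1.42) p.83, (1.37) + (1.30)–(1.31) p.82, (1.35) p.82, (1.66) p.87, (1.29) p.81, (1.19) p.79, Thm 4 p.88, p.77 (bond convention), (1.4) p.77] -/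
theorem H42_of_inAx_γ' (hd2 : 2 ≤ d) {η : ℝ} (hη : 0 < η) {L : ℕ} (hL : 2 ≤ L) (k : ℕ)
    {U₀ U' : Site d → Fin d → 𝔸ˣ} (hU₀ : ∀ x κ, U₀ x κ ∈ unitaryUnits 𝔸)
    {α₀ α₁ α₂ : ℝ} (hα₀ : 0 < α₀) (hα₁ : 0 < α₁) (hα₂ : 0 ≤ α₂)
    -- [3] Prop. 4's windows ONE LEVEL LOWER: at `(L²α₀, Lα₂)` (the box of a datum bond of level `j` lies in `Ω_{j−1}` only)
    (hα3 : C0 d * ((L : ℝ) ^ 2 * α₀) ≤ 1 / 3) (hα4 : 4 * ((L : ℝ) ^ 2 * α₀) ≤ c2' d L) (h16 : 16 * ((L : ℝ) * α₂) ≤ 1)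
    (hsmall : Real.exp (4 * (800 * ((d : ℝ) + 1) ^ 2 * ((d : ℝ) + 4)) * ((L : ℝ) ^ 2 * α₀)) * (1 + 8 * (131072 * ((d : ℝ) + 1) ^ 2) * ((L : ℝ) * α₂)) ≤ 2)
    (hc₃ : 2 * ((L : ℝ) * α₂) ≤ c3 d L) (hsmall₁ : (d : ℝ) * L * α₁ ≤ 1 / 8)
    (Ω : ℕ → Set (Site d)) (hΩ : ∀ j, Ω (j + 1) ⊆ Ω j) (Λs : ℕ → ℕ → Set (Site d)) (Λb : ℕ → ℕ → Set (Site d × Fin d))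
    -- PRINT's box law: the locality box of a datum bond of level `j` lies in `Ω_{j−1}` («Γ_{b₋,x} ⊂ Λ_{j−1}», (1.31); level 0: `Ω₀`)
    (hbox : ∀ m, m ≤ k → ∀ j, j ≤ m → ∀ c ∈ Λb m j, ∀ x, InBox (loK L j c.1) (bondHiK L j c.1 c.2) x → x ∈ Ω (j - 1))
    (hclass : ∀ m, m ≤ k → ∀ j, j ≤ m → ∀ c ∈ Λb m j,
      (c.1 ∈ Λs m j ∧ c.1 + e c.2 ∈ Λs m j) ∨
      (∃ j', j = j' + 1 ∧ (∀ x, (L : ℤ) • c.1 ≤ x → x ≤ (L : ℤ) • c.1 + blockTop L → x ∈ Λs m j') ∧ c.1 + e c.2 ∈ Λs m j) ∨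
      (∃ j', j = j' + 1 ∧ c.1 ∈ Λs m j ∧ (∀ x, (L : ℤ) • (c.1 + e c.2) ≤ x → x ≤ (L : ℤ) • (c.1 + e c.2) + blockTop L → x ∈ Λs m j')))
    (h33 : InAk L k η α₀ Ω U₀) (h34 : InAk L k η α₀ Ω (mulCfg U' U₀)) (hAx : ∀ m, m ≤ k → InAx L m (Λs m) U₀ (mulCfg U' U₀))
    -- (1.35) in PRINT's class: every level-`j` bond with at least one end-BLOCK inside `Ω_j` (p. 77: «at least one end-point of b belongs to Ω», Ω_j = Bʲ(Ω_j^{(j)}))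
    (h135 : ∀ j, j ≤ k → ∀ (z : Site d) (μ : Fin d),
      ((∀ x, InBox (tlo L z j) (thi L z j) x → x ∈ Ω j) ∨ (∀ x, InBox (tlo L (z + e μ) j) (thi L (z + e μ) j) x → x ∈ Ω j)) →
      ‖(avgIter L (mulCfg U' U₀) j z μ : 𝔸) - (avgIter L U₀ j z μ : 𝔸)‖ ≤ α₁)
    (Lan : ℕ → (Site d → Fin d → 𝔸ˣ) → Prop) :
    ∀ m, 1 ≤ m → m ≤ k →
      -- the tower law AT TRUNCATION `m`: the `j`-block of every site of `Λs m j` lies in `Ω_j` ((1.5)–(1.6) p. 77; `ZdIdx.htower` at `m = k`, law (L1) below `k`)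
      (∀ j, j ≤ m → ∀ y ∈ Λs m j, ∀ x, InBox (tlo L y j) (thi L y j) x → x ∈ Ω j) →
      ∀ (u : Site d → 𝔸ˣ) (W : Site d → Fin d → 𝔸ˣ) (A' : Site d → Fin d → 𝔸),
      (∀ x, u x ∈ unitaryUnits 𝔸) → mgauge U₀ u W = U' → Restr129 L m (Λs m) U₀ u → Lan m W →
      (∀ y τ, IsSelfAdjoint (A' y τ)) →
      (∀ j, j ≤ m → ∀ y τ, SideTouches (Ω j) y τ →
        W y τ = cfgExp η A' y τ ∧ ‖A' y τ‖ ≤ α₂ * ((L : ℝ) ^ j * η)⁻¹) →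
      (∀ y τ, (∀ j, j ≤ m → ¬ SideTouches (Ω j) y τ) → A' y τ = 0) →
      ∀ j, j ≤ m → ∀ c ∈ Λb m j, ‖logCovIter L U₀ (iEta η A') j c.1 c.2‖ < 2 * d * L * α₁ := by
  intro m hm1 hmk htw u W A' hu hW h129 hLan hsa hWA hA0 j hj c hc
  have hL1 : 1 ≤ L := le_trans (by norm_num) hL
  have hd1 : 1 ≤ d := le_trans (by norm_num) hd2
  have hLr : (1 : ℝ) ≤ L := by exact_mod_cast hL1
  -- `Ω_{j'+1} ⊆ Ω_{j'} ⊆ Ω_{j'−1}`: the target of the γ box law one level down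
  have hΩp : ∀ i, Ω (i + 1 - 1) ⊆ Ω (i - 1) := by
    intro i x hx
    rw [Nat.add_sub_cancel] at hx
    rcases Nat.eq_zero_or_pos i with rfl | hip
    · simpa using hx
    · obtain ⟨i', rfl⟩ : ∃ i', i = i' + 1 := ⟨i - 1, by omega⟩
      rw [Nat.add_sub_cancel]; exact hΩ i' hx
  have hG : AvgClosed d L (unitaryUnits 𝔸) := avgClosed_unitaryUnits d L
  have hu1 : ∀ x, u x ∈ U1 𝔸 := fun x => unitaryUnits_le_U1 (hu x)
  -- the field `WU₀` is `U′U₀`; its class `𝔄` by gauge invariance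
  have hWU : mgauge U₀ u W * U₀ = mulCfg U' U₀ := by rw [hW]; rfl
  have h34W : InAk L m η α₀ Ω (mulCfg W U₀) := by
    have h1 : InAk L m η α₀ Ω (mulCfg U' U₀) := fun j hj => h34 j (hj.trans hmk)
    have hui : ∀ x, u⁻¹ x ∈ U1 𝔸 := fun x => unitaryUnits_le_U1 ((unitaryUnits 𝔸).inv_mem (hu x))
    rw [B8Prop3GaugeFixedKLevel.mulCfg_eq_gaugeAct_of_mgauge_eq hW]
    exact (B8Ineq132.inAk_gaugeAct_iff L m η α₀ Ω hui _).2 h1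
  -- (87) at all constraint sites, from (1.19)/(1.29)
  have h87 := eq87_of_inAx_restr129 L hL1 m (Λs m) U₀ W u (by rw [hWU]; exact hAx m hmk) h129
  -- `e^{iηA′}` is unitary-valued
  have hBG : ∀ x μ, expCfg (iEta η A') x μ ∈ unitaryUnits 𝔸 := fun x μ => B8Eq155JBound.expCfg_iEta_mem_unitaryUnits η hsa x μ
  -- box data common to all cases, for the bond `c` at its level `j`
  -- reading one level lower: the scale factors
  have hLpos : (0 : ℝ) < L := by exact_mod_cast (lt_of_lt_of_le (by norm_num) hL : 0 < L)
  have hjm1 : j - 1 ≤ m := (Nat.sub_le j 1).trans hj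
  have hpow1 : ((L : ℝ) ^ (j - 1))⁻¹ ≤ (L : ℝ) * ((L : ℝ) ^ j)⁻¹ := by
    rcases Nat.eq_zero_or_pos j with rfl | hjp
    · simp only [Nat.zero_sub, pow_zero, inv_one, mul_one]; exact hLr
    · obtain ⟨i, rfl⟩ : ∃ i, j = i + 1 := ⟨j - 1, by omega⟩
      rw [Nat.add_sub_cancel, pow_succ, mul_inv, ← mul_assoc, mul_comm (L : ℝ), mul_assoc, mul_inv_cancel₀ hLpos.ne', mul_one]
  have hpow2 : (((L : ℝ) ^ (j - 1))⁻¹) ^ 2 ≤ (L : ℝ) ^ 2 * (((L : ℝ) ^ j)⁻¹) ^ 2 := by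
    have h := mul_self_le_mul_self (by positivity) hpow1
    nlinarith [h]
  have hboxbond : ∀ x μ, BondIn (loK L j c.1) (bondHiK L j c.1 c.2) x μ →
      W x μ = cfgExp η A' x μ ∧ ‖iEta η A' x μ‖ ≤ ((L : ℝ) * α₂) * ((L : ℝ) ^ j)⁻¹ := by
    intro x μ hb
    obtain ⟨ν, hν⟩ := exists_ne_dir' hd2 μ
    have hs : SideTouches (Ω (j - 1)) x μ := sideTouches_of_bondTouches hν (Or.inl (hbox m hmk j hj c hc x hb.1))
    obtain ⟨hWx, hAx'⟩ := hWA (j - 1) hjm1 x μ hs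
    refine ⟨hWx, ?_⟩
    show ‖((I : ℂ) * η) • A' x μ‖ ≤ ((L : ℝ) * α₂) * ((L : ℝ) ^ j)⁻¹
    rw [norm_smul, norm_mul, Complex.norm_I, one_mul, Complex.norm_real, Real.norm_eq_abs, abs_of_pos hη]
    calc η * ‖A' x μ‖ ≤ η * (α₂ * ((L : ℝ) ^ (j - 1) * η)⁻¹) := mul_le_mul_of_nonneg_left hAx' hη.le
      _ = α₂ * ((L : ℝ) ^ (j - 1))⁻¹ := by field_simp
      _ ≤ α₂ * ((L : ℝ) * ((L : ℝ) ^ j)⁻¹) := mul_le_mul_of_nonneg_left hpow1 hα₂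
      _ = ((L : ℝ) * α₂) * ((L : ℝ) ^ j)⁻¹ := by ring
  have hag : AgreeOn (loK L j c.1) (bondHiK L j c.1 c.2) W (expCfg (iEta η A')) := fun x μ hx hxe => by
    rw [(hboxbond x μ ⟨hx, hxe⟩).1, expCfg_iEta_apply]
  have hα₀' : 0 < (L : ℝ) ^ 2 * α₀ := by positivity
  have hscale : α₀ * (((L : ℝ) ^ (j - 1))⁻¹) ^ 2 ≤ (L : ℝ) ^ 2 * α₀ * (((L : ℝ) ^ j)⁻¹) ^ 2 := by
    have := mul_le_mul_of_nonneg_left hpow2 hα₀.le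
    linarith [this]
  have h40 : ∀ (x : Site d) (μ ν : Fin d), μ ≠ ν → PlaqIn (loK L j c.1) (bondHiK L j c.1 c.2) (x, μ, ν) →
      ‖((hol U₀ x (plaqWord μ ν) : 𝔸ˣ) : 𝔸) - 1‖ < (L : ℝ) ^ 2 * α₀ * (((L : ℝ) ^ j)⁻¹) ^ 2 :=
    fun x μ ν hμν hp => ((h33 (j - 1) (hjm1.trans hmk)).1 x μ ν hμν (Or.inl (hbox m hmk j hj c hc x hp.1))).trans_le hscale
  have h40' : ∀ (x : Site d) (μ ν : Fin d), μ ≠ ν → PlaqIn (loK L j c.1) (bondHiK L j c.1 c.2) (x, μ, ν) →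
      ‖((hol (W * U₀) x (plaqWord μ ν) : 𝔸ˣ) : 𝔸) - 1‖ < (L : ℝ) ^ 2 * α₀ * (((L : ℝ) ^ j)⁻¹) ^ 2 :=
    fun x μ ν hμν hp => ((h34W (j - 1) hjm1).1 x μ ν hμν (Or.inl (hbox m hmk j hj c hc x hp.1))).trans_le hscale
  -- (1.35) at `c` (an end-point of `c` lies in `Λs m j` in each class case) and on the sub-bonds of a crossing block
  have self_le_add_e : ∀ (z : Site d) (μ : Fin d), z ≤ z + e μ := fun z μ i => by
    show z i ≤ (z + e μ) i
    rw [add_e_apply]; split_ifs <;> omega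
  rcases hclass m hmk j hj c hc with ⟨hy, hyκ⟩ | ⟨j', rfl, hblk, hyκ⟩ | ⟨j', rfl, hy, hblk⟩
  · -- INTERIOR bond: `c₋ ∈ Λs m j`
    have h135c : ‖(avgIter L (mgauge U₀ u W * U₀) j c.1 c.2 : 𝔸) - (avgIter L U₀ j c.1 c.2 : 𝔸)‖ ≤ α₁ := by
      rw [hWU]; exact h135 j (hj.trans hmk) c.1 c.2 (Or.inl (htw j hj c.1 hy))
    rcases j with _ | j
    · -- level 0
      have hb0 : BondIn (loK L 0 c.1) (bondHiK L 0 c.1 c.2) c.1 c.2 := by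
        refine ⟨fun i => ?_, fun i => ?_⟩
        · simp only [loK, bondHiK, pow_zero, one_mul]; split_ifs <;> omega
        · simp only [loK, bondHiK, pow_zero, one_mul, add_e_apply]; split_ifs <;> omega
      obtain ⟨hWc, hAc⟩ := hboxbond c.1 c.2 hb0
      have hlog2 : ‖iEta η A' c.1 c.2‖ < Real.log 2 := by
        have := Real.log_two_gt_d9
        rw [pow_zero, inv_one, mul_one] at hAc
        linarith
      have hm0 : uLev L u 0 c.1 = (wrec L U₀ (expCfg (iEta η A')) 0 c.1)⁻¹ := by
        rw [h87 0 (Nat.zero_le _) c.1 hy, wrec_zero, wrec_zero]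
      have hp0 : uLev L u 0 (c.1 + e c.2) = (wrec L U₀ (expCfg (iEta η A')) 0 (c.1 + e c.2))⁻¹ := by
        rw [h87 0 (Nat.zero_le _) (c.1 + e c.2) hyκ, wrec_zero, wrec_zero]
      have h₀ : avgIter L U₀ 0 c.1 c.2 ∈ U1 𝔸 := by rw [avgIter_zero]; exact unitaryUnits_le_U1 (hU₀ _ _)
      have h135' : ‖(avgIter L (mgauge U₀ u (expCfg (iEta η A')) * U₀) 0 c.1 c.2 : 𝔸) - (avgIter L U₀ 0 c.1 c.2 : 𝔸)‖ ≤ α₁ := by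
        have hpt : (mgauge U₀ u (expCfg (iEta η A')) * U₀) c.1 c.2 = (mgauge U₀ u W * U₀) c.1 c.2 := by
          show mgauge U₀ u (expCfg (iEta η A')) c.1 c.2 * U₀ c.1 c.2 = mgauge U₀ u W c.1 c.2 * U₀ c.1 c.2
          rw [mgauge_apply, mgauge_apply, expCfg_iEta_apply, ← hWc]
        have h := h135c
        rw [avgIter_zero, avgIter_zero] at h ⊢
        rw [hpt]
        exact h
      exact norm_Qj_lt_interior_zero L hd1 hL1 U₀ (iEta η A') u c.1 c.2 hlog2 hm0 hp0 h₀ hα₁ hsmall₁ h135'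
    · -- level `j + 1`
      have hLb : (L : ℝ) ^ (j + 1) * (((L : ℝ) * α₂) * ((L : ℝ) ^ (j + 1))⁻¹) = (L : ℝ) * α₂ := by field_simp
      exact norm_Qj_lt_interior_loc L hd1 hL hG j U₀ c.1 c.2 hU₀ hα₀' hα3 hα4 h40 (iEta η A') (by positivity)
        (fun x μ hbd => (hboxbond x μ hbd).2) (by rw [hLb]; exact hsmall) (by rw [hLb]; exact hc₃) u W hag
        (h87 (j + 1) hj c.1 hy) (h87 (j + 1) hj (c.1 + e c.2) hyκ) hα₁ hsmall₁ h135c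
  · -- CROSSING bond at level `j' + 1`: `c₊ ∈ Λs m (j'+1)`; the block `B(c₋)` consists of level-`j'` constraint sites
    have h135c : ‖(avgIter L (mgauge U₀ u W * U₀) (j' + 1) c.1 c.2 : 𝔸) - (avgIter L U₀ (j' + 1) c.1 c.2 : 𝔸)‖ ≤ α₁ := by
      rw [hWU]; exact h135 (j' + 1) (hj.trans hmk) c.1 c.2 (Or.inr (htw (j' + 1) hj (c.1 + e c.2) hyκ))
    have hLb : (L : ℝ) ^ (j' + 1) * (((L : ℝ) * α₂) * ((L : ℝ) ^ (j' + 1))⁻¹) = (L : ℝ) * α₂ := by field_simp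
    refine norm_Qj_lt_crossing_loc L hd1 hL hG j' U₀ c.1 c.2 hU₀ hα₀' hα3 hα4 h40 (iEta η A') hBG (by positivity)
      (fun x μ hbd => (hboxbond x μ hbd).2) (by rw [hLb]; exact hsmall) (by rw [hLb]; exact hc₃) u hu1 W hag h40'
      (fun x hx1 hx2 => h87 j' (by omega) x (hblk x hx1 hx2)) (h87 (j' + 1) hj (c.1 + e c.2) hyκ) hα₁ hsmall₁
      (fun z μ hz1 hz2 => ?_) h135c
    rw [hWU]
    exact h135 j' (by omega) z μ (Or.inl (htw j' (by omega) z (hblk z hz1 ((self_le_add_e z μ).trans hz2))))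
  · -- MIRRORED crossing bond at level `j' + 1`: `c₋ ∈ Λs m (j'+1)`; the block `B(c₊)` consists of level-`j'` constraint sites
    have h135c : ‖(avgIter L (mgauge U₀ u W * U₀) (j' + 1) c.1 c.2 : 𝔸) - (avgIter L U₀ (j' + 1) c.1 c.2 : 𝔸)‖ ≤ α₁ := by
      rw [hWU]; exact h135 (j' + 1) (hj.trans hmk) c.1 c.2 (Or.inl (htw (j' + 1) hj c.1 hy))
    have hLb : (L : ℝ) ^ (j' + 1) * (((L : ℝ) * α₂) * ((L : ℝ) ^ (j' + 1))⁻¹) = (L : ℝ) * α₂ := by field_simp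
    refine norm_Qj_lt_crossing_mirrored_loc L hd1 hL hG j' U₀ c.1 c.2 hU₀ hα₀' hα3 hα4 h40 (iEta η A') hBG (by positivity)
      (fun x μ hbd => (hboxbond x μ hbd).2) (by rw [hLb]; exact hsmall) (by rw [hLb]; exact hc₃) u hu1 W hag h40'
      (h87 (j' + 1) hj c.1 hy) (fun x hx1 hx2 => h87 j' (by omega) x (hblk x hx1 hx2)) hα₁ hsmall₁
      (fun z μ hz1 hz2 => ?_) h135c
    rw [hWU]
    exact h135 j' (by omega) z μ (Or.inl (htw j' (by omega) z (hblk z hz1 ((self_le_add_e z μ).trans hz2))))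

#print axioms H42_of_inAx_γ'

end Literature.MathematicalPhysics.QuantumFieldTheory.Balaban1983to89.B8Eq142KLevelLocalGammaPrime

end
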